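import Summits.QuantumFields.YangMills.Theorems.BalabanUVNodesN07ChartRemainderP
import Summits.QuantumFields.YangMills.Theorems.UnitScaleTiltProp8FlatChart47Levels
import Summits.QuantumFields.YangMills.Theorems.UnitScaleTiltProp8FlatCubeOpsTextWhole
import HarnessLib

/-!
# BalabanUVNodes ∕ N07 — [15] PROPOSITION 3 FOR THE TRUE MULTI-LEVEL (0.4)-CONSTRAINT: the fixed point `D(A′)` of (49)–(50), its bound (55), and the LINEARISATION
# (48) «`Q(A′ − HD(A′)) = Q_lin A′`» — the change of variables (47) `A = A′ − HD(A′)` of Sect. F (157) — at a generic carrier `P : Params` (⇒ NODE 00's T⁴ tori),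
# from file `…N07ChartRemainderP`'s letters hCd∕hCq and ANY right inverse `H` of the true linearisation with its (46) letter (displayed; dag k0-s1-w1's pen)

Cell `pub-ymgap`, width seat `pub-ymgap-dag-n07-w2` generation 3 (HUMAN RULING D-0149; DAG node N07 = [15] = [Balaban1985Variational]; W-SEAT START LIST §n07 item 2 =
S2 «[15] Sect. C (47)–(49), Prop. 3 at objects»; seam split with dag k0-s1-w1 g3 on the bus 2026-08-28 03:45Z: hH theirs, hCd∕hCq + the composition mine).
`--kind proof --supports stmt-QuantumFields-20542 --as helper` (K1⁷; count-neutral; theorems only).  CONSUMED BY NAME, nothing modified: this seat's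
`N07ChartRemainderP.chartRemainder_hCd_hCq` (hCd ∧ hCq generic in `P`), the route `UnitScaleTilt`'s `FlatChart47Levels.chart47W` ([15] Prop. 3's core with weights, over
abstract `C`, `H`: lit-balaban `B13Contraction113` BY NAME), `Prop8Chart.chartLog`.

THE PRINT ([15] pp. 285–289): «We will construct the linearizing transformation in the form A = A′ − HD(A′), (47) … Q_j(ηA′ − ηHD(A′)) = … = LʲηQ_jA′ on Λ_j, (48) or
C_j(LʲηA′ − LʲηHD(A′)) = D(A′) on Λ_j. (49) Thus the function D(A′) is a fixed point of the transformation X → C_j(LʲηA′ − LʲηHX) (50) … |D(A′)| ≤ 4C₂|A′|²₍₋₁₎ (55) …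
PROPOSITION 3. The transformation (47) satisfying the identity (48), i.e. linearizing the averaging operation Q(ηA), is defined and analytic for A′ satisfying (43) with ε₃
sufficiently small … The function D(A′) satisfies the bound (55)»; Sect. F p. 302: «Now we proceed as in the previous sections, i.e. we make the change of variables
A = A′ − HD(A′)».

WHAT IS PROVED (sorry-free; no definition; axioms standard; fibre `M_n(ℂ)`, any finite `n`).
* §1 ★★★ `exists_chartD_of_rightInverse` — for every torus `P`, height `k`, nested family `D` with `D.k = k` admissible `Adm22 D R′ M` (`2L ≤ R′`, `1 ≤ M`), weights
  `K0FlatCubeOpsTextP.IsLevWeight P k D w`, and every ℂ-linear `H` with `D(chartLog η D)(0) ∘ H = id` and the weighted (46) letter `B₀` (DISPLAYED), every radius `ε > 0`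
  with `9C₂B₀ε < 1`, `3ε ≤ R⋆∕4` (`R⋆ = 1∕(12800ℓ²L)`, `C₂ = 960ℓL∕R⋆`, `ℓ = (d+2)L` — file `…ChartRemainderP`'s k-uniform constants), and every `A′` of weighted size
  `< ε`: there is EXACTLY ONE `D` with `‖D i‖ ≤ 4C₂ε²` and `C(A′ − HD) = D`, `C := chartLog η D − D(chartLog η D)(0)` ((49)–(50)); it obeys (55) `‖D i‖ ≤ 4C₂ρ²` for every
  weighted size bound `ρ ≥ 0` of `A′`; and ★ (48) **`chartLog η D (A′ − H D) = D(chartLog η D)(0) A′`** — in the coordinates `A′` the TRUE constraint «`Q_j(ηA) = B` on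
  `Λ′_j`» ((156)) IS the LINEAR one «`LʲηQ_jA′ = B`» ((157)).  (The empty index set is the trivial case `D = 0`.)
  `exists_eps_chartD` — the `ε`-window is inhabited (A6).
* §2 `size_chartA_le` ((57): weighted size of `A = A′ − HD` `≤ ρ + B₀·4C₂ρ²`), ★★ `chartRange_of_rightInverse` ((59)–(62): every `A` of weighted size `< δ`, `δ + B₀C₂δ² ≤ ε`,
  is reached — `A′ := A + H·C(A)` lies in the `ε`-ball, its `D` is `C(A)`, and `A′ − HD(A′) = A`).  §3 `exists_chartD_of_rightInverse_T4` — §1 on the T⁴ torus `F.P K`.  §4 `chartBinders_inhabited` (A6: the hH-free binder block is inhabited on every torus —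
  the whole-torus family with the canonical weights).

DISPLAYED ∕ NOT HERE.  hH (the right inverse `H` with its letter) — dag k0-s1-w1 g3's pen (OFFER-3 2026-08-28 03:45Z: the record∕generic edition of
`ChartHInv.exists_rightInverse` + `ChartHInvFromFlatOps.hH_of_flatH` from P2's flat `H₀`, with an 𝔰𝔲(N)-projector); when it lands, `hHinv`∕`hHB` below are discharged by
`exact`.  (58) (size of `∇A`), (73) (`δD∕δA′`) and the analyticity of `D` in `A′` are NOT in this file (templates: UST `FlatChart47.grad_chart47_le`, lit-balaban
`B11Prop3Model.norm_fderiv_Dfix_le`, `B13Contraction113.analytic_fixedPoint_113`) — successor pieces.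
Reading (ii): the index set `BondIdx D` is print's (2.3) family (lit-balaban ME #35).  The charted functional is the PLAIN (0.4) tower (dag-n07-e's BRIDGE-92 dressing =
a gauge shear on top, on plan's word).

HONEST FRAMING: composition of kernel theorems; nothing of [15] Sects. D–F asserted; stub 1 ∕ K0⁷ ∕ K1⁷ NOT closed; N07 NOT discharged; counts unmoved (5∕27); one finite T⁴
programme at fixed ε — NOT continuum ∕ ℝ⁴ ∕ OS ∕ mass gap ∕ Clay: the Yang–Mills mass gap is NOT proved by any of this; R4 closes the conditional rung `BalabanLadder.UV` only.
No `sorry`, no `def`, no `instance`, no `notation`.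

References: [15] T. Bałaban, CMP 102 (1985) 277–309 [Balaban1985Variational] ((43)–(50) p.285, (55) p.286, Prop. 3 p.289, (156)–(157) p.302); [B7] CMP 98 (1985) 17–51
[Balaban1985Averaging] (Props. 3–4 pp.36–38); [I] CMP 109 (1987) 249–301 [Balaban1987RG1] ((0.1), (0.4) pp.251–253).
-/

noncomputable section

open scoped BigOperators Matrix.Norms.L2Operator
open NormedSpace Metric Set

namespace Summit.QuantumFields.YangMills.BalabanUVNodes.N07ChartDOfRecord

open Literature.MathematicalPhysics.QuantumFieldTheory.Balaban1983to89
open Literature.MathematicalPhysics.QuantumFieldTheory.Balaban1983to89.T4Continuum (T4Family)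
open Literature.MathematicalPhysics.QuantumFieldTheory.Balaban1983to89.B6SectADomainsV1 (Domains)
open Literature.MathematicalPhysics.QuantumFieldTheory.Balaban1983to89.B6SectAOperatorsV1 (BondIdx)
open Summit.QuantumFields.YangMills.Theorems.FlatCubeOpsText (Adm22)
open Summit.QuantumFields.YangMills.Theorems.K0FlatCubeOpsTextP (IsLevWeight)
open Summit.QuantumFields.YangMills.Theorems.Prop8Chart (chartLog differentiableAt_chartLog_zero)
open Summit.QuantumFields.YangMills.Theorems.FlatChart47Levels (chart47W size_chart47W_le chart47W_range)
open Summit.QuantumFields.YangMills.BalabanUVNodes.N07ChartRemainderP (chartRemainder_hCd_hCq)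
open Summit.QuantumFields.YangMills.Theorems.FlatCubeOpsTextWhole (adm22_whole)
open Literature.MathematicalPhysics.QuantumFieldTheory.Balaban1983to89.B11Eq115Space (levOf)

variable {P : Params} {n : Type*} [Fintype n] [DecidableEq n] [Nonempty n]

/-! ## §1  [15] Proposition 3 for the TRUE multi-level (0.4)-constraint, generic carrier -/

/-- ★★★ **[15] PROPOSITION 3 FOR THE TRUE MULTI-LEVEL (0.4)-CONSTRAINT, GENERIC CARRIER.**  Let `D` be a nested family with `D.k = k`, (2.2)-admissible
(`Adm22 D R′ M`, `2L ≤ R′`, `1 ≤ M`), `w` the level weights, `H` a ℂ-linear right inverse of the TRUE linearisation `D(chartLog η D)(0)` (`η = L^{−k}`) with the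
weighted (46) letter `w 1 b·‖HX(b)‖ ≤ B₀·‖X‖_∞` (displayed), and `ε > 0` with `9C₂B₀ε < 1`, `3ε ≤ R⋆∕4` (`R⋆ = 1∕(12800ℓ²L)`, `C₂ = 960ℓL∕R⋆`).  Then for every `A′`
with `w 1 b·‖A′ b‖ < ε` at every bond: (i) there is EXACTLY ONE `D` with `‖D i‖ ≤ 4C₂ε²` and `C(A′ − HD) = D`, `C := chartLog η D − D(chartLog η D)(0)` — «D(A′) is a
fixed point of the transformation X → C_j(LʲηA′ − LʲηHX) (50)»; (ii) (55) `‖D i‖ ≤ 4C₂ρ²` for every weighted size bound `ρ ≥ 0` of `A′`; (iii) ★ (48)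
`chartLog η D (A′ − H D) = D(chartLog η D)(0) A′` — the change of variables (47) LINEARISES the true constraint.  (`FlatChart47Levels.chart47W` with block weight `1`,
fed by `N07ChartRemainderP.chartRemainder_hCd_hCq`; the empty index set is handled apart.)
[cite: Balaban1985Variational, (47)-(50) p.285, (55) p.286, Prop. 3 p.289, (156)-(157) p.302] -/
theorem exists_chartD_of_rightInverse (k : ℕ) {R' M : ℕ} (hR'L : 2 * P.L ≤ R') (hM : 1 ≤ M) (D : Domains P) (hDk : D.k = k) (hAdm : Adm22 D R' M)
    {w : ℕ → PBond P 0 → ℝ} (hw : IsLevWeight P k D w)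
    (H : (BondIdx D → Matrix n n ℂ) →ₗ[ℂ] (PBond P 0 → Matrix n n ℂ))
    (hHinv : ∀ X, (fderiv ℂ (chartLog (((P.L : ℝ)⁻¹) ^ k) D : (PBond P 0 → Matrix n n ℂ) → BondIdx D → Matrix n n ℂ) 0) (H X) = X)
    {B₀ : ℝ} (hB₀ : 0 ≤ B₀)
    (hHB : ∀ (X : BondIdx D → Matrix n n ℂ) (t : ℝ), 0 ≤ t → (∀ i, ‖X i‖ ≤ t) → ∀ b, w 1 b * ‖H X b‖ ≤ B₀ * t)
    {ε : ℝ} (hε : 0 < ε)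
    (hq : 9 * (960 * (((P.d + 2) * P.L : ℕ) : ℝ) * (P.L : ℝ) / (12800 * (((P.d + 2) * P.L : ℕ) : ℝ) ^ 2 * (P.L : ℝ))⁻¹) * B₀ * ε < 1)
    (h3 : 3 * ε ≤ (12800 * (((P.d + 2) * P.L : ℕ) : ℝ) ^ 2 * (P.L : ℝ))⁻¹ / 4)
    (A' : PBond P 0 → Matrix n n ℂ) (hA' : ∀ b, w 1 b * ‖A' b‖ < ε) :
    let η : ℝ := ((P.L : ℝ)⁻¹) ^ k
    let C₂ : ℝ := 960 * (((P.d + 2) * P.L : ℕ) : ℝ) * (P.L : ℝ) / (12800 * (((P.d + 2) * P.L : ℕ) : ℝ) ^ 2 * (P.L : ℝ))⁻¹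
    let Qlin := (fderiv ℂ (chartLog η D : (PBond P 0 → Matrix n n ℂ) → BondIdx D → Matrix n n ℂ) 0)
    ∃ Dv : BondIdx D → Matrix n n ℂ,
      ((∀ i, ‖Dv i‖ ≤ 4 * C₂ * ε ^ 2) ∧ chartLog η D (A' - H Dv) - Qlin (A' - H Dv) = Dv) ∧
      (∀ D' : BondIdx D → Matrix n n ℂ, (∀ i, ‖D' i‖ ≤ 4 * C₂ * ε ^ 2) → chartLog η D (A' - H D') - Qlin (A' - H D') = D' → D' = Dv) ∧
      (∀ ρ : ℝ, 0 ≤ ρ → (∀ b, w 1 b * ‖A' b‖ ≤ ρ) → ∀ i, ‖Dv i‖ ≤ 4 * C₂ * ρ ^ 2) ∧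
      chartLog η D (A' - H Dv) = Qlin A' := by
  intro η C₂ Qlin
  -- the letters hCd ∧ hCq of file `…N07ChartRemainderP`
  obtain ⟨hCd, hCq⟩ := chartRemainder_hCd_hCq (𝔸 := Matrix n n ℂ) k hR'L hM D hDk hAdm hw
  have hL0 : (0 : ℝ) < P.L := by exact_mod_cast P.L_pos
  have hwpos : ∀ b, 0 < w 1 b := fun b => by rw [hw 1 b, pow_one]; positivity
  have hC₂ : 0 ≤ C₂ := by
    show 0 ≤ 960 * (((P.d + 2) * P.L : ℕ) : ℝ) * (P.L : ℝ) / (12800 * (((P.d + 2) * P.L : ℕ) : ℝ) ^ 2 * (P.L : ℝ))⁻¹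
    positivity
  -- the nonlinear part `C := chartLog − Qlin`
  set C : (PBond P 0 → Matrix n n ℂ) → (BondIdx D → Matrix n n ℂ) := fun Y => chartLog η D Y - Qlin Y with hC
  have hCd' : DifferentiableOn ℂ C {Y : PBond P 0 → Matrix n n ℂ | ∀ b, w 1 b * ‖Y b‖ < (12800 * (((P.d + 2) * P.L : ℕ) : ℝ) ^ 2 * (P.L : ℝ))⁻¹ / 4} :=
    hCd.sub (Qlin.differentiable.differentiableOn)
  have hCq' : ∀ (Y : PBond P 0 → Matrix n n ℂ) (r : ℝ), r < (12800 * (((P.d + 2) * P.L : ℕ) : ℝ) ^ 2 * (P.L : ℝ))⁻¹ / 4 →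
      (∀ b, w 1 b * ‖Y b‖ ≤ r) → ∀ i, (1 : ℝ) * ‖C Y i‖ ≤ C₂ * r ^ 2 := fun Y r hr hY i => by
    rw [one_mul]; exact hCq Y r hr hY i
  -- the empty index set: everything is a function on an empty type
  rcases isEmpty_or_nonempty (BondIdx D) with hE | hNE
  · refine ⟨fun i => hE.elim i, ⟨fun i => hE.elim i, funext fun i => hE.elim i⟩, fun D' _ _ => funext fun i => hE.elim i,
      fun _ _ _ i => hE.elim i, funext fun i => hE.elim i⟩
  -- chart47W's hH letter (block weight 1)
  have hH' : ∀ (X : BondIdx D → Matrix n n ℂ) (t : ℝ), (∀ i, (1 : ℝ) * ‖X i‖ ≤ t) → ∀ b, w 1 b * ‖H X b‖ ≤ B₀ * t := by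
    intro X t hX b
    obtain ⟨i₀⟩ := hNE
    have ht : 0 ≤ t := le_trans (by positivity) ((one_mul (‖X i₀‖)).symm.le.trans (hX i₀))
    exact hHB X t ht (fun i => by simpa only [one_mul] using hX i) b
  obtain ⟨Dv, ⟨hDsz, hDfix⟩, huniq, h55, h48⟩ :=
    chart47W (ι := PBond P 0) (β := BondIdx D) (V := Matrix n n ℂ) (w₀ := w 1) (wB := fun _ => (1 : ℝ)) hwpos (fun _ => one_pos)
      C H hC₂ hB₀ hH' hCq' hCd' hq h3 hε A' hA'
  refine ⟨Dv, ⟨fun i => by simpa only [one_mul] using hDsz i, hDfix⟩, fun D' hD' hfix => huniq D' (fun i => by rw [one_mul]; exact hD' i) hfix,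
    fun ρ hρ hA i => by simpa only [one_mul] using h55 ρ hρ hA i, ?_⟩
  have h := h48 Qlin.toLinearMap (fun X => hHinv X)
  -- `Qlin (A′ − HD) + (chartLog (A′ − HD) − Qlin (A′ − HD)) = Qlin A′`
  have h' : Qlin (A' - H Dv) + (chartLog η D (A' - H Dv) - Qlin (A' - H Dv)) = Qlin A' := h
  rwa [add_sub_cancel] at h'

/-- **THE `ε`-WINDOW OF §1 IS INHABITED** (A6): for `C₂, B₀ ≥ 0` and `R > 0`, `ε := min (R∕3) (1∕(9C₂B₀ + 1))` is positive with `9C₂B₀ε < 1` and `3ε ≤ R`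
(print: «if ε₃ is sufficiently small, e.g., 9C₂B₀ε₃ ≦ ⅔», p.286). [cite: Balaban1985Variational, (54) p.286, Prop. 3 p.289] -/
theorem exists_eps_chartD {C₂ B₀ R : ℝ} (hC₂ : 0 ≤ C₂) (hB₀ : 0 ≤ B₀) (hR : 0 < R) :
    ∃ ε : ℝ, 0 < ε ∧ 9 * C₂ * B₀ * ε < 1 ∧ 3 * ε ≤ R := by
  refine ⟨min (R / 3) (1 / (9 * C₂ * B₀ + 1)), lt_min (by positivity) (by positivity), ?_, ?_⟩
  · have h1 : min (R / 3) (1 / (9 * C₂ * B₀ + 1)) ≤ 1 / (9 * C₂ * B₀ + 1) := min_le_right _ _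
    have h2 : 9 * C₂ * B₀ * (1 / (9 * C₂ * B₀ + 1)) < 1 := by
      rw [mul_one_div, div_lt_one (by positivity)]; linarith
    exact lt_of_le_of_lt (mul_le_mul_of_nonneg_left h1 (by positivity)) h2
  · have : min (R / 3) (1 / (9 * C₂ * B₀ + 1)) ≤ R / 3 := min_le_left _ _
    linarith

/-! ## §2  (57) the size of `A = A′ − HD(A′)`, and (59)–(62) the range of the chart with the explicit preimage -/

omit [Nonempty n] in
/-- The (46) letter in `chart47W`'s shape (block weight `1`) from the shape with `0 ≤ t`, on a NON-EMPTY index set (then `t ≥ 0` is forced).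
[cite: Balaban1985Variational, (46) p.285 (bookkeeping)] -/
theorem hH_weightOne_of_nonempty {D : Domains P} [Nonempty (BondIdx D)] {w : ℕ → PBond P 0 → ℝ}
    (H : (BondIdx D → Matrix n n ℂ) →ₗ[ℂ] (PBond P 0 → Matrix n n ℂ)) {B₀ : ℝ}
    (hHB : ∀ (X : BondIdx D → Matrix n n ℂ) (t : ℝ), 0 ≤ t → (∀ i, ‖X i‖ ≤ t) → ∀ b, w 1 b * ‖H X b‖ ≤ B₀ * t) :
    ∀ (X : BondIdx D → Matrix n n ℂ) (t : ℝ), (∀ i, (1 : ℝ) * ‖X i‖ ≤ t) → ∀ b, w 1 b * ‖H X b‖ ≤ B₀ * t := by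
  intro X t hX b
  obtain ⟨i₀⟩ := ‹Nonempty (BondIdx D)›
  have ht : 0 ≤ t := le_trans (norm_nonneg _) ((one_mul (‖X i₀‖)).symm.le.trans (hX i₀))
  exact hHB X t ht (fun i => by simpa only [one_mul] using hX i) b

omit [Nonempty n] in
/-- **(57) AT THE TRUE CONSTRAINT**: for `A = A′ − HD` with `‖D i‖ ≤ 4C₂ρ²`, weighted size `A′ ≤ ρ`, and the (46) letter of `H` (displayed): weighted size
`A ≤ ρ + B₀·4C₂ρ²` — «|A| ≤ |A′| + B₀(Lʲη)⁻¹4C₂|A′|²₍₋₁₎» (`FlatChart47Levels.size_chart47W_le`, block weight `1`). [cite: Balaban1985Variational, (57) p.286] -/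
theorem size_chartA_le {D : Domains P} {w : ℕ → PBond P 0 → ℝ} (hwpos : ∀ b, 0 < w 1 b)
    (H : (BondIdx D → Matrix n n ℂ) →ₗ[ℂ] (PBond P 0 → Matrix n n ℂ)) {C₂ B₀ ρ : ℝ} (hC₂ : 0 ≤ C₂) (hB₀ : 0 ≤ B₀)
    (hHB : ∀ (X : BondIdx D → Matrix n n ℂ) (t : ℝ), 0 ≤ t → (∀ i, ‖X i‖ ≤ t) → ∀ b, w 1 b * ‖H X b‖ ≤ B₀ * t)
    {A' : PBond P 0 → Matrix n n ℂ} {Dv : BondIdx D → Matrix n n ℂ} (hA' : ∀ b, w 1 b * ‖A' b‖ ≤ ρ) (hD : ∀ i, ‖Dv i‖ ≤ 4 * C₂ * ρ ^ 2) :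
    ∀ b, w 1 b * ‖(A' - H Dv) b‖ ≤ ρ + B₀ * (4 * C₂ * ρ ^ 2) := by
  rcases isEmpty_or_nonempty (BondIdx D) with hE | hNE
  · intro b
    have hDv : Dv = 0 := funext fun i => hE.elim i
    rw [hDv, map_zero, sub_zero]
    exact (hA' b).trans (le_add_of_nonneg_right (by positivity))
  · exact size_chart47W_le (wB := fun _ => (1 : ℝ)) hwpos H (hH_weightOne_of_nonempty H hHB) hA' (fun i => by rw [one_mul]; exact hD i)

/-- ★★ **(59)–(62) AT THE TRUE CONSTRAINT, THE RANGE OF THE CHART WITH THE EXPLICIT PREIMAGE**: under the data of §1 (`9C₂B₀ε < 1`, `3ε ≤ R⋆∕4`) and `0 < δ ≤ ε` with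
`δ + B₀C₂δ² ≤ ε`, every `A` of weighted size `< δ` is reached: `A′ := A + H·C(A)` has weighted size `< ε`, its `D` is `C(A)`, and `A′ − HD(A′) = A` — «To solve the
equation A′ − HD(A′) = A (59) for a given A, we take A′ = A + HX … D(A + HX) = X (60)». (`FlatChart47Levels.chart47W_range`; empty index set apart.)
[cite: Balaban1985Variational, (59)-(62) p.287, Prop. 3 p.289] -/
theorem chartRange_of_rightInverse (k : ℕ) {R' M : ℕ} (hR'L : 2 * P.L ≤ R') (hM : 1 ≤ M) (D : Domains P) (hDk : D.k = k) (hAdm : Adm22 D R' M)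
    {w : ℕ → PBond P 0 → ℝ} (hw : IsLevWeight P k D w)
    (H : (BondIdx D → Matrix n n ℂ) →ₗ[ℂ] (PBond P 0 → Matrix n n ℂ)) {B₀ : ℝ} (hB₀ : 0 ≤ B₀)
    (hHB : ∀ (X : BondIdx D → Matrix n n ℂ) (t : ℝ), 0 ≤ t → (∀ i, ‖X i‖ ≤ t) → ∀ b, w 1 b * ‖H X b‖ ≤ B₀ * t)
    {ε δ : ℝ}
    (hq : 9 * (960 * (((P.d + 2) * P.L : ℕ) : ℝ) * (P.L : ℝ) / (12800 * (((P.d + 2) * P.L : ℕ) : ℝ) ^ 2 * (P.L : ℝ))⁻¹) * B₀ * ε < 1)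
    (h3 : 3 * ε ≤ (12800 * (((P.d + 2) * P.L : ℕ) : ℝ) ^ 2 * (P.L : ℝ))⁻¹ / 4) (hδ0 : 0 < δ) (hδε : δ ≤ ε)
    (hδ : δ + B₀ * ((960 * (((P.d + 2) * P.L : ℕ) : ℝ) * (P.L : ℝ) / (12800 * (((P.d + 2) * P.L : ℕ) : ℝ) ^ 2 * (P.L : ℝ))⁻¹) * δ ^ 2) ≤ ε)
    (A : PBond P 0 → Matrix n n ℂ) (hA : ∀ b, w 1 b * ‖A b‖ < δ) :
    let η : ℝ := ((P.L : ℝ)⁻¹) ^ k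
    let C₂ : ℝ := 960 * (((P.d + 2) * P.L : ℕ) : ℝ) * (P.L : ℝ) / (12800 * (((P.d + 2) * P.L : ℕ) : ℝ) ^ 2 * (P.L : ℝ))⁻¹
    let Qlin := (fderiv ℂ (chartLog η D : (PBond P 0 → Matrix n n ℂ) → BondIdx D → Matrix n n ℂ) 0)
    let C : (PBond P 0 → Matrix n n ℂ) → BondIdx D → Matrix n n ℂ := fun Y => chartLog η D Y - Qlin Y
    (∀ b, w 1 b * ‖(A + H (C A)) b‖ < ε) ∧ (∀ i, ‖C A i‖ ≤ 4 * C₂ * ε ^ 2) ∧ C ((A + H (C A)) - H (C A)) = C A ∧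
      (∀ D' : BondIdx D → Matrix n n ℂ, (∀ i, ‖D' i‖ ≤ 4 * C₂ * ε ^ 2) → C ((A + H (C A)) - H D') = D' → D' = C A) ∧
      (A + H (C A)) - H (C A) = A := by
  intro η C₂ Qlin C
  obtain ⟨hCd, hCq⟩ := chartRemainder_hCd_hCq (𝔸 := Matrix n n ℂ) k hR'L hM D hDk hAdm hw
  have hL0 : (0 : ℝ) < P.L := by exact_mod_cast P.L_pos
  have hwpos : ∀ b, 0 < w 1 b := fun b => by rw [hw 1 b, pow_one]; positivity
  have hC₂ : 0 ≤ C₂ := by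
    show 0 ≤ 960 * (((P.d + 2) * P.L : ℕ) : ℝ) * (P.L : ℝ) / (12800 * (((P.d + 2) * P.L : ℕ) : ℝ) ^ 2 * (P.L : ℝ))⁻¹
    positivity
  have hε : 0 < ε := hδ0.trans_le hδε
  have hCd' : DifferentiableOn ℂ C {Y : PBond P 0 → Matrix n n ℂ | ∀ b, w 1 b * ‖Y b‖ < (12800 * (((P.d + 2) * P.L : ℕ) : ℝ) ^ 2 * (P.L : ℝ))⁻¹ / 4} :=
    hCd.sub (Qlin.differentiable.differentiableOn)
  have hCq' : ∀ (Y : PBond P 0 → Matrix n n ℂ) (r : ℝ), r < (12800 * (((P.d + 2) * P.L : ℕ) : ℝ) ^ 2 * (P.L : ℝ))⁻¹ / 4 →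
      (∀ b, w 1 b * ‖Y b‖ ≤ r) → ∀ i, (1 : ℝ) * ‖C Y i‖ ≤ C₂ * r ^ 2 := fun Y r hr hY i => by
    rw [one_mul]; exact hCq Y r hr hY i
  have hcancel : (A + H (C A)) - H (C A) = A := add_sub_cancel_right _ _
  rcases isEmpty_or_nonempty (BondIdx D) with hE | hNE
  · have hCA : C A = 0 := funext fun i => hE.elim i
    refine ⟨fun b => ?_, fun i => hE.elim i, by rw [hcancel], fun D' _ _ => funext fun i => hE.elim i, hcancel⟩
    rw [hCA, map_zero, add_zero]
    exact (hA b).trans_le hδε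
  · haveI := hNE
    obtain ⟨h1, h2, h3', h4, h5⟩ := chart47W_range (ι := PBond P 0) (β := BondIdx D) (V := Matrix n n ℂ) (w₀ := w 1) (wB := fun _ => (1 : ℝ))
      hwpos (fun _ => one_pos) C H hC₂ hB₀ (hH_weightOne_of_nonempty H hHB) hCq' hCd' hq h3 hδ0 hδε hδ A hA
    exact ⟨h1, fun i => by simpa only [one_mul] using h2 i, h3', fun D' hD' hfix => h4 D' (fun i => by rw [one_mul]; exact hD' i) hfix, h5⟩

/-! ## §3  At NODE 00's record -/

/-- **[15] PROPOSITION 3 AT NODE 00's RECORD**: §1 on the T⁴ torus `F.P K` of a `T4Family` ([Balaban1987RG1] (0.1)), any height `k`, any (2.2)-admissible nested family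
`D : Domains (F.P K)` (e.g. dag-n07-e's `Node00.cubeDomains` with 39b's `Adm22`), fibre `M_n(ℂ)`; hH displayed. [cite: Balaban1985Variational, (47)-(50) p.285, (55) p.286, Prop. 3 p.289, (157) p.302; Balaban1987RG1, (0.1) p.251] -/
theorem exists_chartD_of_rightInverse_T4 (F : T4Family) (K k : ℕ) {R' M : ℕ} (hR'L : 2 * (F.P K).L ≤ R') (hM : 1 ≤ M) (D : Domains (F.P K)) (hDk : D.k = k)
    (hAdm : Adm22 D R' M) {w : ℕ → PBond (F.P K) 0 → ℝ} (hw : IsLevWeight (F.P K) k D w)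
    (H : (BondIdx D → Matrix n n ℂ) →ₗ[ℂ] (PBond (F.P K) 0 → Matrix n n ℂ))
    (hHinv : ∀ X, (fderiv ℂ (chartLog ((((F.P K).L : ℝ)⁻¹) ^ k) D : (PBond (F.P K) 0 → Matrix n n ℂ) → BondIdx D → Matrix n n ℂ) 0) (H X) = X)
    {B₀ : ℝ} (hB₀ : 0 ≤ B₀)
    (hHB : ∀ (X : BondIdx D → Matrix n n ℂ) (t : ℝ), 0 ≤ t → (∀ i, ‖X i‖ ≤ t) → ∀ b, w 1 b * ‖H X b‖ ≤ B₀ * t)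
    {ε : ℝ} (hε : 0 < ε)
    (hq : 9 * (960 * ((((F.P K).d + 2) * (F.P K).L : ℕ) : ℝ) * ((F.P K).L : ℝ) / (12800 * ((((F.P K).d + 2) * (F.P K).L : ℕ) : ℝ) ^ 2 * ((F.P K).L : ℝ))⁻¹) * B₀ * ε < 1)
    (h3 : 3 * ε ≤ (12800 * ((((F.P K).d + 2) * (F.P K).L : ℕ) : ℝ) ^ 2 * ((F.P K).L : ℝ))⁻¹ / 4)
    (A' : PBond (F.P K) 0 → Matrix n n ℂ) (hA' : ∀ b, w 1 b * ‖A' b‖ < ε) :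
    let η : ℝ := (((F.P K).L : ℝ)⁻¹) ^ k
    let C₂ : ℝ := 960 * ((((F.P K).d + 2) * (F.P K).L : ℕ) : ℝ) * ((F.P K).L : ℝ) / (12800 * ((((F.P K).d + 2) * (F.P K).L : ℕ) : ℝ) ^ 2 * ((F.P K).L : ℝ))⁻¹
    let Qlin := (fderiv ℂ (chartLog η D : (PBond (F.P K) 0 → Matrix n n ℂ) → BondIdx D → Matrix n n ℂ) 0)
    ∃ Dv : BondIdx D → Matrix n n ℂ,
      ((∀ i, ‖Dv i‖ ≤ 4 * C₂ * ε ^ 2) ∧ chartLog η D (A' - H Dv) - Qlin (A' - H Dv) = Dv) ∧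
      (∀ D' : BondIdx D → Matrix n n ℂ, (∀ i, ‖D' i‖ ≤ 4 * C₂ * ε ^ 2) → chartLog η D (A' - H D') - Qlin (A' - H D') = D' → D' = Dv) ∧
      (∀ ρ : ℝ, 0 ≤ ρ → (∀ b, w 1 b * ‖A' b‖ ≤ ρ) → ∀ i, ‖Dv i‖ ≤ 4 * C₂ * ρ ^ 2) ∧
      chartLog η D (A' - H Dv) = Qlin A' :=
  exists_chartD_of_rightInverse (P := F.P K) k hR'L hM D hDk hAdm hw H hHinv hB₀ hHB hε hq h3 A' hA'

/-! ## §4  Non-vacuity (A6): the geometric binder block of §1 ∕ file `…ChartRemainderP` is inhabited on every torus -/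

omit [Fintype n] [DecidableEq n] [Nonempty n] in
/-- **THE BINDERS `D.k = k`, `Adm22 D R′ M` (`2L ≤ R′`, `1 ≤ M`), `IsLevWeight P k D w` ARE JOINTLY INHABITED** for every torus `P` and height `k ≤ m + K`: the whole-torus
family `Domains.whole k` ([B6] p.224's admitted case; `FlatCubeOpsTextWhole.adm22_whole`) with the canonical weights; together with `exists_eps_chartD` every hH-free
hypothesis of §1–§2 and of `N07ChartRemainderP.chartRemainder_hCd_hCq` is inhabited (the right inverse `H` — hH — is dag k0-s1-w1's supplier).
[cite: Balaban1984PropagatorsII, (2.1) p.224; Balaban1985Variational, (115) p.295, Prop. 3 p.289 (bookkeeping)] -/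
theorem chartBinders_inhabited (P : Params) {k : ℕ} (hk : k ≤ P.m + P.K) :
    ∃ (D : Domains P) (w : ℕ → PBond P 0 → ℝ) (R' M : ℕ),
      D.k = k ∧ 2 * P.L ≤ R' ∧ 1 ≤ M ∧ Adm22 D R' M ∧ IsLevWeight P k D w :=
  ⟨Domains.whole k hk, fun m b => ((P.L : ℝ) ^ levOf (fun j => {x : Site P 0 | (Domains.whole k hk).InOm j x}) k b.src * ((P.L : ℝ)⁻¹) ^ k) ^ m,
    2 * P.L, 1, rfl, le_rfl, le_rfl, adm22_whole hk _ _, fun _ _ => rfl⟩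

end Summit.QuantumFields.YangMills.BalabanUVNodes.N07ChartDOfRecord

end
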